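import Summits.QuantumFields.YangMills.Theorems.BalabanUVNodesN18KingModelTwoFactor
import Summits.QuantumFields.YangMills.Theorems.BalabanUVNodesN18KingModelScalesPair

/-!
# BalabanUVNodes ∕ N18 — King's Prop. 3.9 (3.75), BOTH entries (the Hölder quotients `∂_α(x, y)` and `∂_α(x, y)∂^η_μ` on the
# first variable), FOR THE TOP-SCALE PIECE `G^η_{(K)} = C^η − G^η_K`, as MULTI-SCALE inhabitants of `T4OutputRate.NE5` for
# King's ACTUAL operators on Bałaban's tori, UNCONDITIONAL — n18-b's files 14b∕14c (the `C^ηQ^*_K` row) and 13 (the Hölder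
# rows of `ℋ_K` and of `∂^η_μℋ_K`, pair-anchored) consumed BY NAME through the two-factor knit `N18KingModelTwoFactor` (Track A,
# DAG node N18 = NE5 `T4OutputRate.NE5 EA EB W κ θ C₅` :211; cluster K4; the -a∕-b loop on the PRINTED MODEL, seventh display)

HONEST FRAMING.  Count-neutral kernel bookkeeping (seat pub-ymgap-dag-n18-a g5; `--supports stmt-QuantumFields-19182`).
King's A = 0 scalar MODEL of the NE5 mechanism (template literature, published and proved) — NOT Bałaban's covariant
one-step outputs `E^{(j)}(X; g, U)`, for which NE5 is NOT IN PRINT and has no tree producer (NODE O 0∕1); NOT a node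
discharge; finite tori; nothing continuum ∕ ℝ⁴ ∕ OS ∕ mass-gap ∕ Clay.  THEOREMS ONLY: 0 `def`, 0 `sorry`, standard axioms.

THE POINT.  King p. 675 claims Prop. 3.9 — hence (3.75) — for `G^η_{(K)}` too.  By the symmetry of `G^η_{(K)}` the Hölder
quotient (3.62) in the first variable lands on the MINIMISER factor of (4.44): `|x − y|^{−α}(G^η_{(K)}(x, z) − G^η_{(K)}(y, z))
= Σ_b C^ηQ^*_K(z, b)·|x − y|^{−α}(ℋ_K(x, b) − ℋ_K(y, b))` (`N18KingModelTwoFactor.htopPiece_eq_sum`; `∂^η_μ` inside: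
`hdtopPiece_eq_sum`) — a TWO-factor graph whose row `C^ηQ^*_K(z, ·)` is n18-b's 14b∕14c (anchored at `B(z)`) and whose
column is file 13's Hölder row of `ℋ_K` (resp. of `∂^η_μℋ_K`), PAIR-anchored at `{B(x), B(y)}` — King's `exp[−δ₀dist({x,y},z)]`:
* §1 **`ne5_kingModel_topPieceHolder_torus`** — (3.75) FIRST entry for `G^η_{(K)}`, `0 < α`, `0 < γ`, `α + γ ≤ 1`: `∃ κ > 0,
  C₅ ≥ 0 (d, L, a, m², γ, α only) ∀ n ≥ 1 ∀ scale-indexed Bałaban tori ∀ carriers (scale X = K ≥ 1; fine points x_A, y_A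
  (the Hölder pair), z_A under x_B, y_B, z_B; d X ≤ min(|B(z_A) − B(x_A)|, |B(z_A) − B(y_A)|)) ∀ read-outs
  EA = |x_A − y_A|^{−α}(G^η_{(K)}(x_A, z_A) − G^η_{(K)}(y_A, z_A)) (`|x − y|` = `holdist`), EB the (K, n)-refined one ∀ W,
  NE5 EA EB W κ (L^{−γ∕2}) C₅` — composition `ne5_of_twoFactorRates_pair_torus` with `hu` ≔ `covQstar_kernel_decay_blocks`,
  `hdu` ≔ `covQstar_row_rate` ∘ `N18KingModelTopPiece.topRate_le_unif`, `hv` ≔ `holder_kernel_decay_blocks`, `hdv` ≔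
  `king_prop38_holder_torus_blocks` ∘ `fprop38Const_le_unif` ∘ `sqrt_rate_le_unif`.
* §2 **`ne5_kingModel_topPieceHolderDeriv_torus`** — (3.75) SECOND entry for `G^η_{(K)}` (`∂^η_μ` inside, a direction
  `μ(X)` read), `α + γ < 1`: same with `hv` ≔ `holder_dkernel_decay_blocks`, `hdv` ≔ `king_prop38_holder_deriv_torus_blocks`.
Literal inhabitants: as in `N18KingModelTorusHolder` §2 (not repeated).  With `N18KingModelTopPiece` ∕ `…TopPieceDeriv`, EVERY
entry of (3.73) ∕ (3.75) for `G^η_{(K)}` is a multi-scale `NE5` inhabitant in the kernel — King's p. 675 claim in full (A = 0).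
NOT COVERED ∕ PINS (standing, ref-B READ #66∕#110∕#263): A = 0, `g`∕`U` unread; periodic b.c.; (2.20) rescaling; `holdist` =
sup torus distance; `t`-derivatives via `m²(t)`; (3.74); the bearing on Bałaban's `E^{(j)}(X; g, U)` is NIL (NODE O + NE2∕NE3).

Sources: C. King, Commun. Math. Phys. **102** (1986) 649–677 [King1986] — p. 675 (4.44)–(4.45), Prop. 3.9 (3.75) p. 665,
(3.62) p. 663, Prop. 3.8 (3.71) p. 664, Prop. 3.7 (3.64) p. 663, Thm 3.3 (3.8) p. 658; T. Bałaban, Commun. Math. Phys. **109**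
(1987) 249–301 [Balaban1987RG1] — Thm 1 p. 259 (uniformity in ε, the only printed trace of NE5).  No claim about the mass gap.
-/

noncomputable section

namespace Summit.QuantumFields.YangMills.BalabanUVNodes.N18KingModelTopPieceHolder

open Real Matrix
open Literature.MathematicalPhysics.QuantumFieldTheory.Balaban1983to89 (Params)
open Literature.MathematicalPhysics.QuantumFieldTheory.Balaban1983to89.T4OutputRate (Carriers Functional NE5)
open Literature.MathematicalPhysics.QuantumFieldTheory.Balaban1983to89.B5Prop11Plancherel (Tor fine unitVec)
open Literature.MathematicalPhysics.QuantumFieldTheory.Balaban1983to89.B4Sect5Proof (latticeConst latticeConst_nonneg)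
open Literature.MathematicalPhysics.QuantumFieldTheory.King1986
  (aK aK_pos lemma43Const prop38RateConst prop38PosConst fprop38RateConst fprop38PosConst exp_decay_mono)
open Literature.MathematicalPhysics.QuantumFieldTheory.King1986.Torus
  (topPiece covQstar minimiser blockOf blockOf_over tdistT tdistT_nonneg holdist covQstar_kernel_decay_blocks
    covQstar_row_rate holder_kernel_decay_blocks king_prop38_holder_torus_blocks holder_dkernel_decay_blocks
    king_prop38_holder_deriv_torus_blocks)
open Summit.QuantumFields.YangMills.BalabanUVNodes.N18KingModel (prop38Const_unif_nonneg kingTheta_pos)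
open Summit.QuantumFields.YangMills.BalabanUVNodes.N18KingModelTopPiece (topRate_le_unif)
open Summit.QuantumFields.YangMills.BalabanUVNodes.N18KingModelScalesPair
  (fprop38Const_le_unif sqrt_rate_le_unif aliasConst_nonneg_of_lt_one)
open Summit.QuantumFields.YangMills.BalabanUVNodes.N18KingModelTwoFactor
  (ne5_of_twoFactorRates_pair_torus htopPiece_eq_sum hdtopPiece_eq_sum)

variable {d : ℕ}

/-! ## §1 (3.75), first entry, for the top piece, on Bałaban's tori: both factors BY NAME -/

/-- **KING'S (3.75), FIRST ENTRY (THE HÖLDER QUOTIENT `∂_α(x, y)`), FOR THE TOP-SCALE PIECE `G^η_{(K)}` AS A MULTI-SCALE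
INHABITANT OF N18's DECL OF RECORD — UNCONDITIONAL FOR KING'S ACTUAL OPERATORS ON BAŁABAN'S TORI.**  For `d ≥ 1`, odd
`L > 1`, `a > 0`, `m² > 0`, `0 < α`, `0 < γ`, `α + γ ≤ 1` there are `κ > 0`, `C₅ ≥ 0` (functions of `d, L, a, m², γ, α` only)
such that: for every `n ≥ 1`; every scale-indexed family of Bałaban unit tori; every carriers `C` with `1 ≤ scale X` whose
domain `X` of scale `K` reads fine points `x_A(X)`, `y_A(X)` (the Hölder pair) and `z_A(X)` UNDER `x_B(X)`, `y_B(X)`, `z_B(X)`,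
with tree length `≤ min(|B(z_A) − B(x_A)|_{T₁}, |B(z_A) − B(y_A)|_{T₁})` (King's `dist({x, y}, z)`); every two functionals
reading `(∂_α(x_A, y_A)G^η_{(K)})(z_A) = |x_A − y_A|^{−α}(topPiece … x_A z_A − topPiece … y_A z_A)` and its (K, n)-refinement —
King's ACTUAL `A = 0` operators; every window: `NE5 EA EB W κ (L^{−γ∕2}) C₅`.
[cite: King1986, p.675 (4.44), Prop. 3.9 (3.75) p.665, (3.62) p.663, Prop. 3.8 (3.71) p.664, Thm 3.3 (3.8) p.658] -/
theorem ne5_kingModel_topPieceHolder_torus (hd : 1 ≤ d) (L : ℕ) [NeZero L] (hLp : Odd L ∧ 1 < L) {a m2 : ℝ}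
    (ha : 0 < a) (hm : 0 < m2) {α γ : ℝ} (hα : 0 < α) (hγ : 0 < γ) (hαγ : α + γ ≤ 1) :
    ∃ κ C₅ : ℝ, 0 < κ ∧ 0 ≤ C₅ ∧
      ∀ (n : ℕ) (_hn : 1 ≤ n) (M : ℕ → Fin d → ℕ) [∀ j μ, NeZero (M j μ)]
        (_hM : ∀ j, ∃ mm : ℕ, ∀ μ, L * M j μ = 2 * L ^ mm)
        (C : Carriers) (_hsc : ∀ X, 1 ≤ C.scale X)
        (xA yA zA : (X : C.Dom) → Tor (fine (L ^ C.scale X) (fine L (M (C.scale X)))))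
        (xB yB zB : (X : C.Dom) → Tor (fine (L ^ n * L ^ C.scale X) (fine L (M (C.scale X)))))
        (_hx : ∀ X μ, (xA X μ).val = (xB X μ).val / L ^ n)
        (_hy : ∀ X μ, (yA X μ).val = (yB X μ).val / L ^ n)
        (_hz : ∀ X μ, (zA X μ).val = (zB X μ).val / L ^ n)
        (_hd : ∀ X, C.d X ≤ min
            (tdistT (fine L (M (C.scale X))) (blockOf (L ^ C.scale X) (fine L (M (C.scale X))) (zA X))
              (blockOf (L ^ C.scale X) (fine L (M (C.scale X))) (xA X)))
            (tdistT (fine L (M (C.scale X))) (blockOf (L ^ C.scale X) (fine L (M (C.scale X))) (zA X))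
              (blockOf (L ^ C.scale X) (fine L (M (C.scale X))) (yA X))))
        (EA : Functional C C.BgA) (EB : Functional C C.BgB)
        (_hEA : ∀ g U X, EA g U X =
          (holdist (L ^ C.scale X) (fine L (M (C.scale X))) (xA X) (yA X)) ^ (-α)
            * (topPiece (L ^ C.scale X) (fine L (M (C.scale X))) (aK a L (C.scale X)) (((L ^ C.scale X : ℕ) : ℝ) ^ 2) m2
                  (xA X) (zA X)
              - topPiece (L ^ C.scale X) (fine L (M (C.scale X))) (aK a L (C.scale X)) (((L ^ C.scale X : ℕ) : ℝ) ^ 2) m2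
                  (yA X) (zA X)))
        (_hEB : ∀ g U X, EB g U X =
          (holdist (L ^ n * L ^ C.scale X) (fine L (M (C.scale X))) (xB X) (yB X)) ^ (-α)
            * (topPiece (L ^ n * L ^ C.scale X) (fine L (M (C.scale X))) (aK a L (C.scale X + n))
                  (((L ^ n * L ^ C.scale X : ℕ) : ℝ) ^ 2) m2 (xB X) (zB X)
              - topPiece (L ^ n * L ^ C.scale X) (fine L (M (C.scale X))) (aK a L (C.scale X + n))
                  (((L ^ n * L ^ C.scale X : ℕ) : ℝ) ^ 2) m2 (yB X) (zB X)))
        (W : Set (ℕ → ℝ)),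
        NE5 EA EB W κ ((L : ℝ) ^ (-(γ / 2))) C₅ := by
  have hd0 : 0 < d := hd
  have hL2 : 2 ≤ L := by have := hLp.2; omega
  have hLr : (1 : ℝ) < L := by exact_mod_cast hLp.2
  have hα1 : α < 1 := by linarith
  have hγ1 : γ ≤ 1 := by linarith
  -- the four one-line packages of n18-b, BY NAME: the `C^ηQ^*_K` row (14b∕14c), the Hölder column (file 13)
  obtain ⟨δb, cb, hδb, hcb, Hb⟩ := covQstar_kernel_decay_blocks d L hd hLp.1 hL2 ha hm
  obtain ⟨δc, cc, hδc, hcc, Hc⟩ := covQstar_row_rate d L hd hLp.1 hL2 ha hm hγ.le hγ1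
  obtain ⟨δH, cH, hδH, hcH, HH⟩ := holder_kernel_decay_blocks d L hd hLp.1 hL2 ha hm hα hα1
  obtain ⟨δR, cR, hδR, hcR, HR⟩ := king_prop38_holder_torus_blocks d L hd hLp.1 hL2 ha hm hα hγ hαγ
  -- common rates
  set δ₁ : ℝ := min δb δc with hδ₁
  set δ₂ : ℝ := min δH (δR / 2) with hδ₂
  have hδ₁pos : 0 < δ₁ := lt_min hδb hδc
  have hδ₂pos : 0 < δ₂ := lt_min hδH (half_pos hδR)
  have hδ₁b : δ₁ ≤ δb := min_le_left _ _
  have hδ₁c : δ₁ ≤ δc := min_le_right _ _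
  have hδ₂H : δ₂ ≤ δH := min_le_left _ _
  have hδ₂R : δ₂ ≤ δR / 2 := min_le_right _ _
  set δ : ℝ := min δ₁ δ₂ / 2 with hδ
  have hδpos : 0 < δ := half_pos (lt_min hδ₁pos hδ₂pos)
  have hδA : 2 * δ ≤ δ₁ := by rw [hδ]; linarith [min_le_left δ₁ δ₂]
  have hδB : 2 * δ ≤ δ₂ := by rw [hδ]; linarith [min_le_right δ₁ δ₂]
  -- the uniform letters
  set Cu : ℝ := prop38RateConst a a (a * (2 * ((a * (1 - ((L : ℝ) ^ 2)⁻¹))⁻¹ + π ^ 2 / 48 + 1 / 3)))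
      ((π ^ 2 / 4) ^ d) d γ + prop38PosConst a ((π ^ 2 / 4) ^ d) d γ with hCu
  set CuH : ℝ := fprop38RateConst a a (a * (2 * ((a * (1 - ((L : ℝ) ^ 2)⁻¹))⁻¹ + π ^ 2 / 48 + 1 / 3)))
      ((π ^ 2 / 4) ^ d) d γ α (2 * (d : ℝ) ^ α) 0
      + fprop38PosConst a ((π ^ 2 / 4) ^ d) d γ α (2 * (d : ℝ) ^ α) (6 * (d : ℝ) ^ (α + γ)) with hCuH
  have hCu0 : 0 ≤ Cu := prop38Const_unif_nonneg hd0 ha hL2 (by linarith : γ < 2)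
  have hAC : 0 ≤ Literature.MathematicalPhysics.QuantumFieldTheory.King1986.aliasConst d (α + γ - 1) :=
    aliasConst_nonneg_of_lt_one hd0 (by linarith)
  set cA : ℝ := cc * Real.sqrt Cu + cc with hcA
  set cB : ℝ := Real.sqrt (2 * cR * CuH) with hcB
  have hcA0 : 0 ≤ cA := by positivity
  have hcB0 : 0 ≤ cB := Real.sqrt_nonneg _
  have hθ : 0 ≤ (L : ℝ) ^ (-(γ / 2)) := (kingTheta_pos (by omega) _).le
  have hKd : 0 ≤ latticeConst d δ := latticeConst_nonneg d hδpos.le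
  refine ⟨δ, 2 * ((cA * cH + cb * cB) * latticeConst d δ), hδpos, by positivity, ?_⟩
  intro n hn M _ hM C hsc xA yA zA xB yB zB hx hy hz hdd EA EB hEA hEB W
  refine ne5_of_twoFactorRates_pair_torus (C := C) (EA := EA) (EB := EB) (W := W) L M
    (fun X => blockOf (L ^ C.scale X) (fine L (M (C.scale X))) (zA X))
    (fun X => blockOf (L ^ C.scale X) (fine L (M (C.scale X))) (xA X))
    (fun X => blockOf (L ^ C.scale X) (fine L (M (C.scale X))) (yA X))
    (fun X b => covQstar (L ^ C.scale X) (fine L (M (C.scale X))) (((L ^ C.scale X : ℕ) : ℝ) ^ 2) m2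
      (Pi.single b 1) (zA X))
    (fun X b => covQstar (L ^ n * L ^ C.scale X) (fine L (M (C.scale X))) (((L ^ n * L ^ C.scale X : ℕ) : ℝ) ^ 2) m2
      (Pi.single b 1) (zB X))
    (fun X b => (holdist (L ^ C.scale X) (fine L (M (C.scale X))) (xA X) (yA X)) ^ (-α)
      * (minimiser (L ^ C.scale X) (fine L (M (C.scale X))) (aK a L (C.scale X)) (((L ^ C.scale X : ℕ) : ℝ) ^ 2) m2
            (Pi.single b 1) (xA X)
          - minimiser (L ^ C.scale X) (fine L (M (C.scale X))) (aK a L (C.scale X)) (((L ^ C.scale X : ℕ) : ℝ) ^ 2) m2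
            (Pi.single b 1) (yA X)))
    (fun X b => (holdist (L ^ n * L ^ C.scale X) (fine L (M (C.scale X))) (xB X) (yB X)) ^ (-α)
      * (minimiser (L ^ n * L ^ C.scale X) (fine L (M (C.scale X))) (aK a L (C.scale X + n))
            (((L ^ n * L ^ C.scale X : ℕ) : ℝ) ^ 2) m2 (Pi.single b 1) (xB X)
          - minimiser (L ^ n * L ^ C.scale X) (fine L (M (C.scale X))) (aK a L (C.scale X + n))
            (((L ^ n * L ^ C.scale X : ℕ) : ℝ) ^ 2) m2 (Pi.single b 1) (yB X)))
    hδpos hδA hδB hθ hcb.le hcH.le hcA0 hcB0 ?_ ?_ ?_ ?_ hdd ?_ ?_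
  · intro X b
    obtain ⟨mm, hmm⟩ := hM (C.scale X)
    have hMK : ∀ μ, fine L (M (C.scale X)) μ
        = (⟨d, L, mm, C.scale X, hd, hLp⟩ : Params).sitesPerDir (C.scale X) := fun μ => by
      simp only [Params.sitesPerDir, Nat.add_sub_cancel]; exact hmm μ
    have h := Hb ⟨d, L, mm, C.scale X, hd, hLp⟩ rfl rfl (hsc X) (fine L (M (C.scale X))) hMK (L ^ C.scale X) rfl
      (zA X) b
    exact h.trans (exp_decay_mono hcb.le hδ₁b (tdistT_nonneg _ _ _))
  · intro X b
    obtain ⟨mm, hmm⟩ := hM (C.scale X)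
    have hMK : ∀ μ, fine L (M (C.scale X)) μ
        = (⟨d, L, mm, C.scale X + n, hd, hLp⟩ : Params).sitesPerDir (C.scale X + n) := fun μ => by
      simp only [Params.sitesPerDir, Nat.add_sub_cancel]; exact hmm μ
    have hN : L ^ n * L ^ C.scale X = L ^ (C.scale X + n) := by rw [pow_add, mul_comm]
    have h := HH ⟨d, L, mm, C.scale X + n, hd, hLp⟩ rfl rfl (show 1 ≤ C.scale X + n by have := hsc X; omega)
      (fine L (M (C.scale X))) hMK (L ^ n * L ^ C.scale X) hN (xB X) (yB X) b
    rw [blockOf_over (fine L (M (C.scale X))) (xA X) (xB X) (hx X),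
      blockOf_over (fine L (M (C.scale X))) (yA X) (yB X) (hy X)] at h
    exact h.trans (exp_decay_mono hcH.le hδ₂H (le_min (tdistT_nonneg _ _ _) (tdistT_nonneg _ _ _)))
  · intro X b
    obtain ⟨mm, hmm⟩ := hM (C.scale X)
    have hMK : ∀ μ, fine L (M (C.scale X)) μ
        = (⟨d, L, mm, C.scale X, hd, hLp⟩ : Params).sitesPerDir (C.scale X) := fun μ => by
      simp only [Params.sitesPerDir, Nat.add_sub_cancel]; exact hmm μ
    haveI : NeZero (⟨d, L, mm, C.scale X, hd, hLp⟩ : Params).L := ‹NeZero L›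
    have h := Hc ⟨d, L, mm, C.scale X, hd, hLp⟩ rfl rfl (hsc X) n hn (fine L (M (C.scale X))) hMK
      (zA X) (zB X) b (hz X)
    refine (h.trans (exp_decay_mono (by positivity) hδ₁c (tdistT_nonneg _ _ _))).trans ?_
    exact mul_le_mul_of_nonneg_right (topRate_le_unif hd0 ha hL2 (hsc X) hn hγ1 hcc.le (K := C.scale X) (n := n))
      (Real.exp_pos _).le
  · intro X b
    obtain ⟨mm, hmm⟩ := hM (C.scale X)
    have hMK : ∀ μ, fine L (M (C.scale X)) μ
        = (⟨d, L, mm, C.scale X, hd, hLp⟩ : Params).sitesPerDir (C.scale X) := fun μ => by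
      simp only [Params.sitesPerDir, Nat.add_sub_cancel]; exact hmm μ
    haveI : NeZero (⟨d, L, mm, C.scale X, hd, hLp⟩ : Params).L := ‹NeZero L›
    have h := HR ⟨d, L, mm, C.scale X, hd, hLp⟩ rfl rfl (hsc X) n hn (fine L (M (C.scale X))) hMK
      (xA X) (yA X) (xB X) (yB X) b (hx X) (hy X)
    have hm0 : 0 ≤ min (tdistT (fine L (M (C.scale X))) (blockOf (L ^ C.scale X) (fine L (M (C.scale X))) (xA X)) b)
        (tdistT (fine L (M (C.scale X))) (blockOf (L ^ C.scale X) (fine L (M (C.scale X))) (yA X)) b) :=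
      le_min (tdistT_nonneg _ _ _) (tdistT_nonneg _ _ _)
    refine (h.trans (exp_decay_mono (Real.sqrt_nonneg _) hδ₂R hm0)).trans ?_
    refine mul_le_mul_of_nonneg_right ?_ (Real.exp_pos _).le
    exact sqrt_rate_le_unif (fprop38Const_le_unif ha hL2 (hsc X) hn (by positivity) (by positivity) hAC)
      (by positivity) L (C.scale X) γ
  · intro g U X
    rw [hEA]
    exact htopPiece_eq_sum (L ^ C.scale X) (fine L (M (C.scale X))) (aK_pos ha hLr (hsc X)).le (by positivity) hm _ _ _ _
  · intro g U X
    rw [hEB]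
    exact htopPiece_eq_sum (L ^ n * L ^ C.scale X) (fine L (M (C.scale X)))
      (aK_pos ha hLr (show 1 ≤ C.scale X + n by have := hsc X; omega)).le (by positivity) hm _ _ _ _

/-! ## §2 (3.75), second entry (`∂^η_μ` inside the Hölder quotient), for the top piece -/

/-- **KING'S (3.75), SECOND ENTRY (`∂_α(x, y)∂^η_μ`), FOR THE TOP-SCALE PIECE `G^η_{(K)}` AS A MULTI-SCALE INHABITANT OF N18's
DECL OF RECORD — UNCONDITIONAL FOR KING'S ACTUAL OPERATORS ON BAŁABAN'S TORI.**  As §1 with a direction `μ(X)` read and the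
column `b ↦ |x_A − y_A|^{−α}(∂^η_μℋ_K(x_A, b) − ∂^η_μℋ_K(y_A, b))` (`∂^η_μℋ_K = L^K(ℋ_K(· + e_μ) − ℋ_K)`), `α + γ < 1`; read-out
`|x_A − y_A|^{−α}(∂^η_μG^η_{(K)}(x_A, z_A) − ∂^η_μG^η_{(K)}(y_A, z_A))` (`hdtopPiece_eq_sum`); inputs file 13 §5–§6 and 14b∕14c.
[cite: King1986, p.675 (4.44), Prop. 3.9 (3.75) p.665, (3.62) p.663, Prop. 3.8 (3.71) p.664, Thm 3.3 (3.8) p.658] -/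
theorem ne5_kingModel_topPieceHolderDeriv_torus (hd : 1 ≤ d) (L : ℕ) [NeZero L] (hLp : Odd L ∧ 1 < L) {a m2 : ℝ}
    (ha : 0 < a) (hm : 0 < m2) {α γ : ℝ} (hα : 0 < α) (hγ : 0 < γ) (hαγ : α + γ < 1) :
    ∃ κ C₅ : ℝ, 0 < κ ∧ 0 ≤ C₅ ∧
      ∀ (n : ℕ) (_hn : 1 ≤ n) (M : ℕ → Fin d → ℕ) [∀ j μ, NeZero (M j μ)]
        (_hM : ∀ j, ∃ mm : ℕ, ∀ μ, L * M j μ = 2 * L ^ mm)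
        (C : Carriers) (_hsc : ∀ X, 1 ≤ C.scale X) (dir : C.Dom → Fin d)
        (xA yA zA : (X : C.Dom) → Tor (fine (L ^ C.scale X) (fine L (M (C.scale X)))))
        (xB yB zB : (X : C.Dom) → Tor (fine (L ^ n * L ^ C.scale X) (fine L (M (C.scale X)))))
        (_hx : ∀ X μ, (xA X μ).val = (xB X μ).val / L ^ n)
        (_hy : ∀ X μ, (yA X μ).val = (yB X μ).val / L ^ n)
        (_hz : ∀ X μ, (zA X μ).val = (zB X μ).val / L ^ n)
        (_hd : ∀ X, C.d X ≤ min
            (tdistT (fine L (M (C.scale X))) (blockOf (L ^ C.scale X) (fine L (M (C.scale X))) (zA X))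
              (blockOf (L ^ C.scale X) (fine L (M (C.scale X))) (xA X)))
            (tdistT (fine L (M (C.scale X))) (blockOf (L ^ C.scale X) (fine L (M (C.scale X))) (zA X))
              (blockOf (L ^ C.scale X) (fine L (M (C.scale X))) (yA X))))
        (EA : Functional C C.BgA) (EB : Functional C C.BgB)
        (_hEA : ∀ g U X, EA g U X =
          (holdist (L ^ C.scale X) (fine L (M (C.scale X))) (xA X) (yA X)) ^ (-α)
            * (((L ^ C.scale X : ℕ) : ℝ)
                * (topPiece (L ^ C.scale X) (fine L (M (C.scale X))) (aK a L (C.scale X))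
                      (((L ^ C.scale X : ℕ) : ℝ) ^ 2) m2
                      (xA X + unitVec (fine (L ^ C.scale X) (fine L (M (C.scale X)))) (dir X)) (zA X)
                  - topPiece (L ^ C.scale X) (fine L (M (C.scale X))) (aK a L (C.scale X))
                      (((L ^ C.scale X : ℕ) : ℝ) ^ 2) m2 (xA X) (zA X))
              - ((L ^ C.scale X : ℕ) : ℝ)
                * (topPiece (L ^ C.scale X) (fine L (M (C.scale X))) (aK a L (C.scale X))
                      (((L ^ C.scale X : ℕ) : ℝ) ^ 2) m2
                      (yA X + unitVec (fine (L ^ C.scale X) (fine L (M (C.scale X)))) (dir X)) (zA X)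
                  - topPiece (L ^ C.scale X) (fine L (M (C.scale X))) (aK a L (C.scale X))
                      (((L ^ C.scale X : ℕ) : ℝ) ^ 2) m2 (yA X) (zA X))))
        (_hEB : ∀ g U X, EB g U X =
          (holdist (L ^ n * L ^ C.scale X) (fine L (M (C.scale X))) (xB X) (yB X)) ^ (-α)
            * (((L ^ n * L ^ C.scale X : ℕ) : ℝ)
                * (topPiece (L ^ n * L ^ C.scale X) (fine L (M (C.scale X))) (aK a L (C.scale X + n))
                      (((L ^ n * L ^ C.scale X : ℕ) : ℝ) ^ 2) m2
                      (xB X + unitVec (fine (L ^ n * L ^ C.scale X) (fine L (M (C.scale X)))) (dir X)) (zB X)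
                  - topPiece (L ^ n * L ^ C.scale X) (fine L (M (C.scale X))) (aK a L (C.scale X + n))
                      (((L ^ n * L ^ C.scale X : ℕ) : ℝ) ^ 2) m2 (xB X) (zB X))
              - ((L ^ n * L ^ C.scale X : ℕ) : ℝ)
                * (topPiece (L ^ n * L ^ C.scale X) (fine L (M (C.scale X))) (aK a L (C.scale X + n))
                      (((L ^ n * L ^ C.scale X : ℕ) : ℝ) ^ 2) m2
                      (yB X + unitVec (fine (L ^ n * L ^ C.scale X) (fine L (M (C.scale X)))) (dir X)) (zB X)
                  - topPiece (L ^ n * L ^ C.scale X) (fine L (M (C.scale X))) (aK a L (C.scale X + n))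
                      (((L ^ n * L ^ C.scale X : ℕ) : ℝ) ^ 2) m2 (yB X) (zB X))))
        (W : Set (ℕ → ℝ)),
        NE5 EA EB W κ ((L : ℝ) ^ (-(γ / 2))) C₅ := by
  have hd0 : 0 < d := hd
  have hL2 : 2 ≤ L := by have := hLp.2; omega
  have hLr : (1 : ℝ) < L := by exact_mod_cast hLp.2
  have hα1 : α < 1 := by linarith
  have hγ1 : γ ≤ 1 := by linarith
  obtain ⟨δb, cb, hδb, hcb, Hb⟩ := covQstar_kernel_decay_blocks d L hd hLp.1 hL2 ha hm
  obtain ⟨δc, cc, hδc, hcc, Hc⟩ := covQstar_row_rate d L hd hLp.1 hL2 ha hm hγ.le hγ1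
  obtain ⟨δH, cH, hδH, hcH, HH⟩ := holder_dkernel_decay_blocks d L hd hLp.1 hL2 ha hm hα hα1
  obtain ⟨δR, cR, hδR, hcR, HR⟩ := king_prop38_holder_deriv_torus_blocks d L hd hLp.1 hL2 ha hm hα hγ hαγ
  set δ₁ : ℝ := min δb δc with hδ₁
  set δ₂ : ℝ := min δH (δR / 2) with hδ₂
  have hδ₁pos : 0 < δ₁ := lt_min hδb hδc
  have hδ₂pos : 0 < δ₂ := lt_min hδH (half_pos hδR)
  have hδ₁b : δ₁ ≤ δb := min_le_left _ _
  have hδ₁c : δ₁ ≤ δc := min_le_right _ _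
  have hδ₂H : δ₂ ≤ δH := min_le_left _ _
  have hδ₂R : δ₂ ≤ δR / 2 := min_le_right _ _
  set δ : ℝ := min δ₁ δ₂ / 2 with hδ
  have hδpos : 0 < δ := half_pos (lt_min hδ₁pos hδ₂pos)
  have hδA : 2 * δ ≤ δ₁ := by rw [hδ]; linarith [min_le_left δ₁ δ₂]
  have hδB : 2 * δ ≤ δ₂ := by rw [hδ]; linarith [min_le_right δ₁ δ₂]
  set Cu : ℝ := prop38RateConst a a (a * (2 * ((a * (1 - ((L : ℝ) ^ 2)⁻¹))⁻¹ + π ^ 2 / 48 + 1 / 3)))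
      ((π ^ 2 / 4) ^ d) d γ + prop38PosConst a ((π ^ 2 / 4) ^ d) d γ with hCu
  set CuH : ℝ := fprop38RateConst a a (a * (2 * ((a * (1 - ((L : ℝ) ^ 2)⁻¹))⁻¹ + π ^ 2 / 48 + 1 / 3)))
      ((π ^ 2 / 4) ^ d) d γ (α + 1) (2 * (d : ℝ) ^ α) (2 * (d : ℝ) ^ α * 2 ^ (1 - γ))
      + fprop38PosConst a ((π ^ 2 / 4) ^ d) d γ (α + 1) (2 * (d : ℝ) ^ α) (6 * (d : ℝ) ^ (α + γ)) with hCuH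
  have hCu0 : 0 ≤ Cu := prop38Const_unif_nonneg hd0 ha hL2 (by linarith : γ < 2)
  have hAC : 0 ≤ Literature.MathematicalPhysics.QuantumFieldTheory.King1986.aliasConst d (α + 1 + γ - 1) :=
    aliasConst_nonneg_of_lt_one hd0 (by linarith)
  set cA : ℝ := cc * Real.sqrt Cu + cc with hcA
  set cB : ℝ := Real.sqrt (2 * cR * CuH) with hcB
  have hcA0 : 0 ≤ cA := by positivity
  have hcB0 : 0 ≤ cB := Real.sqrt_nonneg _
  have hθ : 0 ≤ (L : ℝ) ^ (-(γ / 2)) := (kingTheta_pos (by omega) _).le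
  have hKd : 0 ≤ latticeConst d δ := latticeConst_nonneg d hδpos.le
  refine ⟨δ, 2 * ((cA * cH + cb * cB) * latticeConst d δ), hδpos, by positivity, ?_⟩
  intro n hn M _ hM C hsc dir xA yA zA xB yB zB hx hy hz hdd EA EB hEA hEB W
  refine ne5_of_twoFactorRates_pair_torus (C := C) (EA := EA) (EB := EB) (W := W) L M
    (fun X => blockOf (L ^ C.scale X) (fine L (M (C.scale X))) (zA X))
    (fun X => blockOf (L ^ C.scale X) (fine L (M (C.scale X))) (xA X))
    (fun X => blockOf (L ^ C.scale X) (fine L (M (C.scale X))) (yA X))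
    (fun X b => covQstar (L ^ C.scale X) (fine L (M (C.scale X))) (((L ^ C.scale X : ℕ) : ℝ) ^ 2) m2
      (Pi.single b 1) (zA X))
    (fun X b => covQstar (L ^ n * L ^ C.scale X) (fine L (M (C.scale X))) (((L ^ n * L ^ C.scale X : ℕ) : ℝ) ^ 2) m2
      (Pi.single b 1) (zB X))
    (fun X b => (holdist (L ^ C.scale X) (fine L (M (C.scale X))) (xA X) (yA X)) ^ (-α)
      * (((L ^ C.scale X : ℕ) : ℝ)
          * (minimiser (L ^ C.scale X) (fine L (M (C.scale X))) (aK a L (C.scale X)) (((L ^ C.scale X : ℕ) : ℝ) ^ 2) m2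
                (Pi.single b 1) (xA X + unitVec (fine (L ^ C.scale X) (fine L (M (C.scale X)))) (dir X))
              - minimiser (L ^ C.scale X) (fine L (M (C.scale X))) (aK a L (C.scale X)) (((L ^ C.scale X : ℕ) : ℝ) ^ 2) m2
                (Pi.single b 1) (xA X))
        - ((L ^ C.scale X : ℕ) : ℝ)
          * (minimiser (L ^ C.scale X) (fine L (M (C.scale X))) (aK a L (C.scale X)) (((L ^ C.scale X : ℕ) : ℝ) ^ 2) m2
                (Pi.single b 1) (yA X + unitVec (fine (L ^ C.scale X) (fine L (M (C.scale X)))) (dir X))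
              - minimiser (L ^ C.scale X) (fine L (M (C.scale X))) (aK a L (C.scale X)) (((L ^ C.scale X : ℕ) : ℝ) ^ 2) m2
                (Pi.single b 1) (yA X))))
    (fun X b => (holdist (L ^ n * L ^ C.scale X) (fine L (M (C.scale X))) (xB X) (yB X)) ^ (-α)
      * (((L ^ n * L ^ C.scale X : ℕ) : ℝ)
          * (minimiser (L ^ n * L ^ C.scale X) (fine L (M (C.scale X))) (aK a L (C.scale X + n))
                (((L ^ n * L ^ C.scale X : ℕ) : ℝ) ^ 2) m2 (Pi.single b 1)
                (xB X + unitVec (fine (L ^ n * L ^ C.scale X) (fine L (M (C.scale X)))) (dir X))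
              - minimiser (L ^ n * L ^ C.scale X) (fine L (M (C.scale X))) (aK a L (C.scale X + n))
                (((L ^ n * L ^ C.scale X : ℕ) : ℝ) ^ 2) m2 (Pi.single b 1) (xB X))
        - ((L ^ n * L ^ C.scale X : ℕ) : ℝ)
          * (minimiser (L ^ n * L ^ C.scale X) (fine L (M (C.scale X))) (aK a L (C.scale X + n))
                (((L ^ n * L ^ C.scale X : ℕ) : ℝ) ^ 2) m2 (Pi.single b 1)
                (yB X + unitVec (fine (L ^ n * L ^ C.scale X) (fine L (M (C.scale X)))) (dir X))
              - minimiser (L ^ n * L ^ C.scale X) (fine L (M (C.scale X))) (aK a L (C.scale X + n))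
                (((L ^ n * L ^ C.scale X : ℕ) : ℝ) ^ 2) m2 (Pi.single b 1) (yB X))))
    hδpos hδA hδB hθ hcb.le hcH.le hcA0 hcB0 ?_ ?_ ?_ ?_ hdd ?_ ?_
  · intro X b
    obtain ⟨mm, hmm⟩ := hM (C.scale X)
    have hMK : ∀ μ, fine L (M (C.scale X)) μ
        = (⟨d, L, mm, C.scale X, hd, hLp⟩ : Params).sitesPerDir (C.scale X) := fun μ => by
      simp only [Params.sitesPerDir, Nat.add_sub_cancel]; exact hmm μ
    have h := Hb ⟨d, L, mm, C.scale X, hd, hLp⟩ rfl rfl (hsc X) (fine L (M (C.scale X))) hMK (L ^ C.scale X) rfl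
      (zA X) b
    exact h.trans (exp_decay_mono hcb.le hδ₁b (tdistT_nonneg _ _ _))
  · intro X b
    obtain ⟨mm, hmm⟩ := hM (C.scale X)
    have hMK : ∀ μ, fine L (M (C.scale X)) μ
        = (⟨d, L, mm, C.scale X + n, hd, hLp⟩ : Params).sitesPerDir (C.scale X + n) := fun μ => by
      simp only [Params.sitesPerDir, Nat.add_sub_cancel]; exact hmm μ
    have hN : L ^ n * L ^ C.scale X = L ^ (C.scale X + n) := by rw [pow_add, mul_comm]
    have h := HH ⟨d, L, mm, C.scale X + n, hd, hLp⟩ rfl rfl (show 1 ≤ C.scale X + n by have := hsc X; omega)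
      (fine L (M (C.scale X))) hMK (L ^ n * L ^ C.scale X) hN (xB X) (yB X) b (dir X)
    rw [blockOf_over (fine L (M (C.scale X))) (xA X) (xB X) (hx X),
      blockOf_over (fine L (M (C.scale X))) (yA X) (yB X) (hy X)] at h
    exact h.trans (exp_decay_mono hcH.le hδ₂H (le_min (tdistT_nonneg _ _ _) (tdistT_nonneg _ _ _)))
  · intro X b
    obtain ⟨mm, hmm⟩ := hM (C.scale X)
    have hMK : ∀ μ, fine L (M (C.scale X)) μ
        = (⟨d, L, mm, C.scale X, hd, hLp⟩ : Params).sitesPerDir (C.scale X) := fun μ => by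
      simp only [Params.sitesPerDir, Nat.add_sub_cancel]; exact hmm μ
    haveI : NeZero (⟨d, L, mm, C.scale X, hd, hLp⟩ : Params).L := ‹NeZero L›
    have h := Hc ⟨d, L, mm, C.scale X, hd, hLp⟩ rfl rfl (hsc X) n hn (fine L (M (C.scale X))) hMK
      (zA X) (zB X) b (hz X)
    refine (h.trans (exp_decay_mono (by positivity) hδ₁c (tdistT_nonneg _ _ _))).trans ?_
    exact mul_le_mul_of_nonneg_right (topRate_le_unif hd0 ha hL2 (hsc X) hn hγ1 hcc.le (K := C.scale X) (n := n))
      (Real.exp_pos _).le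
  · intro X b
    obtain ⟨mm, hmm⟩ := hM (C.scale X)
    have hMK : ∀ μ, fine L (M (C.scale X)) μ
        = (⟨d, L, mm, C.scale X, hd, hLp⟩ : Params).sitesPerDir (C.scale X) := fun μ => by
      simp only [Params.sitesPerDir, Nat.add_sub_cancel]; exact hmm μ
    haveI : NeZero (⟨d, L, mm, C.scale X, hd, hLp⟩ : Params).L := ‹NeZero L›
    have h := HR ⟨d, L, mm, C.scale X, hd, hLp⟩ rfl rfl (hsc X) n hn (fine L (M (C.scale X))) hMK
      (xA X) (yA X) (xB X) (yB X) b (hx X) (hy X) (dir X)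
    have hm0 : 0 ≤ min (tdistT (fine L (M (C.scale X))) (blockOf (L ^ C.scale X) (fine L (M (C.scale X))) (xA X)) b)
        (tdistT (fine L (M (C.scale X))) (blockOf (L ^ C.scale X) (fine L (M (C.scale X))) (yA X)) b) :=
      le_min (tdistT_nonneg _ _ _) (tdistT_nonneg _ _ _)
    refine (h.trans (exp_decay_mono (Real.sqrt_nonneg _) hδ₂R hm0)).trans ?_
    refine mul_le_mul_of_nonneg_right ?_ (Real.exp_pos _).le
    exact sqrt_rate_le_unif (fprop38Const_le_unif ha hL2 (hsc X) hn (by positivity) (by positivity) hAC)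
      (by positivity) L (C.scale X) γ
  · intro g U X
    rw [hEA]
    exact hdtopPiece_eq_sum (L ^ C.scale X) (fine L (M (C.scale X))) (aK_pos ha hLr (hsc X)).le (by positivity) hm
      _ _ _ _ _ _
  · intro g U X
    rw [hEB]
    exact hdtopPiece_eq_sum (L ^ n * L ^ C.scale X) (fine L (M (C.scale X)))
      (aK_pos ha hLr (show 1 ≤ C.scale X + n by have := hsc X; omega)).le (by positivity) hm _ _ _ _ _ _

end Summit.QuantumFields.YangMills.BalabanUVNodes.N18KingModelTopPieceHolder

end
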